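/-
Copyright (c) 2026 the pub-hodgecm-mathlib formalisation cell (harness21).  Prover seat hodgecm-mathlib-K2E3-p05 (g3), Track B «K2-LIT», engine E3, unit U4 «Keys»,
2026-09-04.  KERNEL module: THEOREMS ONLY (no definition, no named fact, no `sorry`, no instance, no notation).
-/
import Summits.HodgeConjecture.HodgeConjecture.Theorems.K2E3IwahoriLine                         -- ★ II-3″ p856542 (this base, g2): `exists_iwahoriLine`; brings ★ II-3∕II-3′, ★ II-1 `exists_iwahoriPair`, ★ (G3) letters
import Summits.HodgeConjecture.HodgeConjecture.Theorems.K2E3ParahoricAverageK1                   -- ★ II-2b p856231 (g2): `avgProj_K1_eq`; brings ★ II-2a p855830 `avgProj_K0_eq`, ★ `avgProj`, `avgProjLinear`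
import Summits.HodgeConjecture.HodgeConjecture.Theorems.K2E3ParahoricReducibilityCriterion      -- ★ II-4abs p855172 (g0): `criterion_of_iwahoriLine`
import Summits.HodgeConjecture.HodgeConjecture.Theorems.K2E3IwahoriScalarExplicit               -- ★-filed p856662 (g3): the explicit `d`, `‖ϖ_E‖ = q_v⁻²`, `|R| = [K : K ∩ I]`
import Summits.HodgeConjecture.HodgeConjecture.Theorems.K2E3SphericalCFunctionUnramifiedHypotheses   -- ★ p856288 (K2E3-p04 g2): (H1) `χ₁ = 1` on `𝒪_vˣ`, `|χ₁(ϖ)| < 1`; brings ★ `apply_eq_apply_uniformizer_zpow`, ★ NonUnitaryCharacterDichotomy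
import Summits.HodgeConjecture.HodgeConjecture.Theorems.F0P3cStCharTSStParahoricFixed          -- ★ `exists_torus_diag_one_one`, `cmTorusCharPair_diag_one_one` (`d(1,b,1) ∈ T ∩ K_v`)
import Literature.NumberTheory.Automorphic.UnitaryLatticeTreeValencyInertPlace                  -- ★ inert heads `fintypeCard_valuedResidueField_eq_sq_of_inert`, `residueHom_galAdicCompletionMap_eq_pow_valued`; ★ `index_inf_subgroupOf_eq_of_unramified` via LevelIndices
import HarnessLib

/-!
# K2 ∕ E3 «EllipticInputs», unit U4 «Keys» — Road II of MEMO `hK-KeysThmTwo`, THE ASSEMBLY II-4 (quartet form): for an UNRAMIFIED non-unitary contracting `χ = (χ₁, χ₂)` at an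
# INERT place, a reducible `i_G(χ)` forces `χ₂ = 1` and `χ₁(ϖ_E) ∈ {q_v⁻², −q_v⁻¹}` — Keys' Theorem §7 (2) (a)(c) read at the Iwahori level [Keys1984 §7; Casselman1980 §3; Borel1976 §4]

Cell hodgecm-mathlib (D-0151), FLOOR 0, Track B «K2-LIT», engine E3, crux item H413 = stmt-HodgeConjecture-24833 (route `HCCMUnconditional`, no route verbs); target BY NAME
`…K2E3EllipticInputs.U4Keys.sig_K2E3KeysThmTwoContracting` (U4-f, U4Keys ED. 4), unramified first rung (Road II).  Author K2E3-p05 (g3).  `--supports stmt-HodgeConjecture-24833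
--as helper`; THEOREMS ONLY; letters of ★ (G3)-EXPLICIT ∕ ★ PS-LEVELS (`w hw eA heA hd g₁ hg₁ K0 K1 I hK0 hK1 hI`; `v` inert: `hd : UnramifiedLocalConjDatum` + `hunr`).

THE MATHEMATICS (MEMO v3 steps 1–5).  `χ = (χ₁, χ₂)` continuous on `T(L⁺_v) = E_vˣ × E¹_v`, trivial on `T ∩ K_v` (`hU`), `χ₁` non-unitary (`hnu`) and contracting (`hcontr`), `⊥ ≠ N ≠ ⊤`
a `G_v`-stable subspace of `V = i_G(χ)`.  §1: `hU` forces `χ₂ = 1` (`d(1, b, 1) ∈ T ∩ K_v` for every `b ∈ E¹_v`, ★ `exists_torus_diag_one_one`) and `χ₁ = 1` on `𝒪_vˣ` (★ (H1)), hence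
the Weyl conjugate `wχ = (χ̄₁⁻¹, χ₂)` is trivial on `T ∩ K_v` too.  §2: `χ` is REGULAR (★ `cmTorusCharPair_ne_weyl_of_exists_norm_ne_one`), so ★ II-3″ `exists_iwahoriLine` gives the
line `N ∩ (ℂf₁ ⊕ ℂf_w) = ℂu` on the Iwahori plane of ★ II-1 `exists_iwahoriPair`; the parahoric averages `e_{K₀}, e_{K₁}` (★ `avgProjLinear`) preserve `N`, land in the spherical
lines, and act on the plane by the forms of ★ II-2a ∕ II-2b: `(a₀ : b₀) = |R|⁻¹(1 : |R|−1)` against `f₁ + f_w`, `(a₁ : b₁) = |R′|⁻¹(|R′|−1 : μ)` against `f₁ + μ⁻¹f_w`, where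
`|R| = [K₀ : I] = q³ + 1`, `|R′| = [K₁ : I] = q + 1` (★ `index_inf_subgroupOf_eq_of_unramified` at the inert heads ★ `fintypeCard_valuedResidueField_eq_sq_of_inert` ∕
★ `residueHom_galAdicCompletionMap_eq_pow_valued`, ★ `card_eq_index_of_isLeftTransversal`) and `μ = χ(proj d)·δ_B^{1∕2}(d) = χ₁(ϖ_E)⁻¹·q²` for the explicit `d` of ★
`exists_borel_mul_weyl_mem_K1_explicit` (`(proj d)₀₀ = ϖ⁻¹`, ★ `‖ϖ_E‖ = q⁻²`).  ★ `criterion_of_iwahoriLine` then reads `μ ∈ {q³·q, 1, −q, −q³}`, i.e. with `z = χ₁(ϖ_E)`,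
`|z| < 1` (contracting, ★ `norm_apply_uniformizer_lt_one_of_contracting`): `z ∈ {q⁻², q², −q, −q⁻¹} ∩ {|z| < 1} = {q⁻², −q⁻¹}` — Keys' points (a) `λ_s = |·|_E` and (c) `λ_s = η|·|_E^{1∕2}`,
`η` the unramified quadratic character.  The translation of the two values into U4-f's disjuncts (`χ₁ = ‖·‖_E`, `χ₁ = η‖·‖^{1∕2}` with `η|F^× = ω_{E∕F}`) is the sequel (★ p855859
`eq_halfModulusChar_sq_of_apply_uniformizer` + the unit-norm lemma).
HONEST LABEL: HC_CM is proved only modulo the 7 printed citations (2 remaining named inputs: hLiu418 = stmt-HodgeConjecture-24832, h413 = stmt-HodgeConjecture-24833) until rung 0 closes; count-neutral (the unramified rung does NOT pay U4-f).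

## References
* [Keys1984] D. Keys, *Principal series representations of special unitary groups over local fields*, Compositio Math. 51 (1984), §7 Theorem (2) (a)(c) p. 126.
* [Casselman1980] W. Casselman, Compositio Math. 40 (1980), §3.  * [Borel1976] A. Borel, Invent. Math. 35 (1976), §4.  * [Rogawski1990] Ann. of Math. Stud. 123 (1990), §12.2 (1)(2) p. 173.  * [Tits1979] PSPM 33.1 (1979), §2.4.
-/

set_option autoImplicit false
-- the mandated namespace has the single-problem summit's repeated segment (`HodgeConjecture.HodgeConjecture`)
set_option linter.dupNamespace false

noncomputable section

open NumberField IsDedekindDomain MeasureTheory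
open scoped Matrix MatrixGroups NNReal WithZero Valued
open Literature.NumberTheory Literature.NumberTheory.Automorphic Literature.NumberTheory.Automorphic.UnitaryGroup
open Literature.NumberTheory.Rogawski1990 Literature.NumberTheory.GaloisRepresentations

namespace Summit.HodgeConjecture.HodgeConjecture.Cruxes.H413.K2E3KeysThmTwoIwahoriQuartet

open Summit.HodgeConjecture.HodgeConjecture.Cruxes.H413
open Summit.HodgeConjecture.HodgeConjecture.Cruxes.H413.F0P3cStCharTSStLevelsTransport
open Summit.HodgeConjecture.HodgeConjecture.Cruxes.H413.K2E3PSIwahoriBasis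
open Summit.HodgeConjecture.HodgeConjecture.Cruxes.H413.K2E3ParahoricAverageK0
open Summit.HodgeConjecture.HodgeConjecture.Cruxes.H413.K2E3ParahoricAverageK1
open Summit.HodgeConjecture.HodgeConjecture.Cruxes.H413.K2E3ParahoricReducibilityCriterion
open Summit.HodgeConjecture.HodgeConjecture.Cruxes.H413.K2E3IwahoriScalarExplicit

variable (L : Type) [Field L] [NumberField L] [IsCMField L] (v : HeightOneSpectrum (𝓞 ↥(maximalRealSubfield L)))

/-! ## §1 An unramified pair character: `χ₂ = 1`, `χ₁ = 1` on `𝒪_vˣ`, and `wχ` is unramified too -/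

/-- **`hU ⇒ χ₂ = 1`**: if `χ = (χ₁, χ₂)` is trivial on `T ∩ K_v` then `χ₂` is trivial (`d(1, b, 1) ∈ T ∩ K_v` with `χ(d(1,b,1)) = χ₂(b)` for every `b ∈ E¹_v`, ★ `exists_torus_diag_one_one`,
★ `cmTorusCharPair_diag_one_one`). `v` non-split. [cite: Rogawski1990, §12.1 p. 171; §12.2 p. 173] [cite: Keys1984, §7 p. 126] -/
theorem eq_one_of_levelTrivial (hns : ∀ w : PlacesOver L v, IsCMField.complexConj L • w.1 = w.1)
    (χ₁ : (LocalRing L v)ˣ →* ℂˣ) (χ₂ : ↥(normOneUnits (conjLocal L (IsCMField.complexConj L) v)) →* ℂˣ)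
    (hU : ∀ t : ↥(torusU (conjLocal L (IsCMField.complexConj L) v) (cmLocalForm L 3 v)),
      (t : ↥(unitaryGroupOfForm (conjLocal L (IsCMField.complexConj L) v) (cmLocalForm L 3 v))) ∈ cmLocalIntegralLevel L 3 (qsForm L) v → cmTorusCharPair L v χ₁ χ₂ t = 1) :
    χ₂ = 1 := by
  refine MonoidHom.ext fun b => ?_
  obtain ⟨t, ht, htK⟩ := F0P3cStCharTSStParahoricFixed.exists_torus_diag_one_one L v hns b
  have h := hU t htK
  rw [F0P3cStCharTSStParahoricFixed.cmTorusCharPair_diag_one_one L v χ₁ χ₂ b t ht] at h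
  rw [h, MonoidHom.one_apply]

/-- **`hU ⇒ hUw`**: if `χ = (χ₁, χ₂)` is trivial on `T ∩ K_v` then so is its Weyl conjugate `wχ = (χ̄₁⁻¹, χ₂)` (`χ₂ = 1`, `χ₁ = 1` on `𝒪_vˣ` ★ (H1), and `σ` preserves `𝒪_vˣ` ★
`valued_conjLocal_apply_of_smul_eq`; the diagonal of `t ∈ T ∩ K_v` is unit-valued ★ `v_torusEntry_eq_one_of_mem_cmLocalIntegralLevel`). `v` non-split. [cite: Rogawski1990, §12.2 p. 173] -/
theorem weyl_levelTrivial (hns : ∀ w : PlacesOver L v, IsCMField.complexConj L • w.1 = w.1)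
    (χ₁ : (LocalRing L v)ˣ →* ℂˣ) (χ₂ : ↥(normOneUnits (conjLocal L (IsCMField.complexConj L) v)) →* ℂˣ)
    (hU : ∀ t : ↥(torusU (conjLocal L (IsCMField.complexConj L) v) (cmLocalForm L 3 v)),
      (t : ↥(unitaryGroupOfForm (conjLocal L (IsCMField.complexConj L) v) (cmLocalForm L 3 v))) ∈ cmLocalIntegralLevel L 3 (qsForm L) v → cmTorusCharPair L v χ₁ χ₂ t = 1) :
    ∀ t : ↥(torusU (conjLocal L (IsCMField.complexConj L) v) (cmLocalForm L 3 v)),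
      (t : ↥(unitaryGroupOfForm (conjLocal L (IsCMField.complexConj L) v) (cmLocalForm L 3 v))) ∈ cmLocalIntegralLevel L 3 (qsForm L) v →
        cmTorusCharPair L v (conjInvChar (conjLocal L (IsCMField.complexConj L) v) χ₁) χ₂ t = 1 := by
  intro t ht
  have hχ₂ := eq_one_of_levelTrivial L v hns χ₁ χ₂ hU
  rw [cmTorusCharPair, torusCharPair_apply, hχ₂, MonoidHom.one_apply, mul_one, conjInvChar_apply, inv_eq_one]
  refine K2E3SphericalCFunctionUnramifiedHypotheses.apply_eq_one_of_mem_unitsIntegers_of_trivial L v hns χ₁ χ₂ hU _ ?_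
  rw [F0P3cStCharTSTorusCompactPart.mem_unitsIntegers_iff]
  intro w'
  rw [Units.coe_map, MonoidHom.coe_coe, valued_conjLocal_apply_of_smul_eq L v w' (hns w')]
  exact v_torusEntry_eq_one_of_mem_cmLocalIntegralLevel L 3 v t ht 0 w'

/-! ## §2 The arithmetic of the four cases -/

/-- **The four equations of ★ `criterion_of_iwahoriLine` solved for `z = χ₁(ϖ_E)`**: with `|R| = q³ + 1`, `|R′| = q + 1`, `μ = z⁻¹q²`, `|z| < 1`, `q ≥ 2`, the four cases
`det = 0` ∕ `c = 1` ∕ `a₁ + b₁ = 0` ∕ `a₀ + b₀c = 0` read `μ = q⁴` ∕ `μ = 1` ∕ `μ = −q` ∕ `μ = −q³`, i.e. `z ∈ {q⁻², q², −q, −q⁻¹}`, and `|z| < 1` leaves `z = q⁻²` or `z = −q⁻¹`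
(pure algebra in `ℂ`). [cite: Keys1984, §7 Theorem (2) (a)(c) p. 126] [cite: Rogawski1990, §12.2 (1)(2) p. 173] -/
theorem quartet_algebra (q : ℕ) (hq : 2 ≤ q) (z μ : ℂ) (hz0 : z ≠ 0) (hz : ‖z‖ < 1) (hμ : μ = z⁻¹ * (q : ℂ) ^ 2)
    (h : ((q : ℂ) ^ 3 + 1)⁻¹ * (((q : ℂ) + 1)⁻¹ * μ) - ((q : ℂ) ^ 3 + 1)⁻¹ * ((q : ℂ) ^ 3 + 1 - 1) * (((q : ℂ) + 1)⁻¹ * ((q : ℂ) + 1 - 1)) = 0 ∨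
      μ⁻¹ = 1 ∨ ((q : ℂ) + 1)⁻¹ * ((q : ℂ) + 1 - 1) + ((q : ℂ) + 1)⁻¹ * μ = 0 ∨
      ((q : ℂ) ^ 3 + 1)⁻¹ + ((q : ℂ) ^ 3 + 1)⁻¹ * ((q : ℂ) ^ 3 + 1 - 1) * μ⁻¹ = 0) :
    z = ((q : ℂ) ^ 2)⁻¹ ∨ z = -((q : ℂ))⁻¹ := by
  have hqR : (2 : ℝ) ≤ (q : ℝ) := by exact_mod_cast hq
  have hq0 : (q : ℂ) ≠ 0 := by exact_mod_cast (show q ≠ 0 by omega)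
  have hq2 : (q : ℂ) ^ 2 ≠ 0 := pow_ne_zero _ hq0
  have hn0 : (q : ℂ) ^ 3 + 1 ≠ 0 := by
    have : ((q : ℂ) ^ 3 + 1) = (((q : ℝ) ^ 3 + 1 : ℝ) : ℂ) := by push_cast; ring
    rw [this, Complex.ofReal_ne_zero]; positivity
  have hm0 : (q : ℂ) + 1 ≠ 0 := by
    have : ((q : ℂ) + 1) = (((q : ℝ) + 1 : ℝ) : ℂ) := by push_cast; ring
    rw [this, Complex.ofReal_ne_zero]; positivity
  have hμ0 : μ ≠ 0 := by rw [hμ]; exact mul_ne_zero (inv_ne_zero hz0) hq2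
  have hzinv : ∀ c : ℂ, z⁻¹ * (q : ℂ) ^ 2 = c → z⁻¹ = c * ((q : ℂ) ^ 2)⁻¹ := fun c e => by
    rw [← e, mul_inv_cancel_right₀ hq2]
  rcases h with h | h | h | h
  · -- determinant: `μ = q³·q`, `z = q⁻²`
    left
    have h' : ((q : ℂ) ^ 3 + 1) * ((q : ℂ) + 1) *
        (((q : ℂ) ^ 3 + 1)⁻¹ * (((q : ℂ) + 1)⁻¹ * μ) - ((q : ℂ) ^ 3 + 1)⁻¹ * ((q : ℂ) ^ 3 + 1 - 1) * (((q : ℂ) + 1)⁻¹ * ((q : ℂ) + 1 - 1))) =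
        μ - (q : ℂ) ^ 3 * (q : ℂ) := by
      field_simp
      ring
    rw [h, mul_zero] at h'
    have hμ' : μ = (q : ℂ) ^ 3 * (q : ℂ) := (sub_eq_zero.1 h'.symm)
    have e := hzinv _ (hμ.symm.trans hμ')
    rw [← inv_inv z, e]
    field_simp
  · -- `μ = 1`: `z = q²`, too big
    exfalso
    have hμ1 : μ = 1 := inv_eq_one.1 h
    have e := hzinv _ (hμ.symm.trans hμ1)
    have hz' : z = (q : ℂ) ^ 2 := by rw [← inv_inv z, e, one_mul, inv_inv]
    have : ‖z‖ = (q : ℝ) ^ 2 := by rw [hz', norm_pow, Complex.norm_natCast]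
    nlinarith
  · -- `μ = −q`: `z = −q`, too big
    exfalso
    have h' : ((q : ℂ) + 1) * (((q : ℂ) + 1)⁻¹ * ((q : ℂ) + 1 - 1) + ((q : ℂ) + 1)⁻¹ * μ) = (q : ℂ) + μ := by
      field_simp
      ring
    rw [h, mul_zero] at h'
    have hμ' : μ = -(q : ℂ) := by linear_combination -h'
    have e := hzinv _ (hμ.symm.trans hμ')
    have hz' : z = -(q : ℂ) := by
      rw [← inv_inv z, e]
      field_simp
    have : ‖z‖ = (q : ℝ) := by rw [hz', norm_neg, Complex.norm_natCast]
    linarith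
  · -- `μ = −q³`: `z = −q⁻¹`
    right
    have h' : ((q : ℂ) ^ 3 + 1) * μ * (((q : ℂ) ^ 3 + 1)⁻¹ + ((q : ℂ) ^ 3 + 1)⁻¹ * ((q : ℂ) ^ 3 + 1 - 1) * μ⁻¹) = μ + (q : ℂ) ^ 3 := by
      field_simp
      ring
    rw [h, mul_zero] at h'
    have hμ' : μ = -(q : ℂ) ^ 3 := by linear_combination -h'
    have e := hzinv _ (hμ.symm.trans hμ')
    rw [← inv_inv z, e]
    field_simp

/-! ## §3 The representation-theoretic datum: the criterion's four-way disjunction for an unramified `i_G(χ)` -/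

variable (w : PlacesOver L v) (hw : IsCMField.complexConj L • w.1 = w.1)
  (eA : Gqs L v ≃ₜ* ↥(unitaryGroupOfForm (galAdicCompletionMap (L := L) (IsCMField.complexConj L) hw) ((StdForm.antidiagonal 3).over (w.1.adicCompletion L))))
  (heA : ∀ g : Gqs L v,
    ((eA g : ↥(unitaryGroupOfForm (galAdicCompletionMap (L := L) (IsCMField.complexConj L) hw) ((StdForm.antidiagonal 3).over (w.1.adicCompletion L)))) : GL (Fin 3) (w.1.adicCompletion L)) =
      ((localNonsplitEquiv (IsCMField.complexConj L) (qsForm L) (IsCMField.complexConj_ne_one L) w hw g :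
        ↥(unitaryGroupOfForm (galAdicCompletionMap (L := L) (IsCMField.complexConj L) hw) (placeForm (qsForm L) w.1))) : GL (Fin 3) (w.1.adicCompletion L)))

include heA in
set_option maxHeartbeats 16000000 in
set_option synthInstance.maxHeartbeats 400000 in
-- statement∕proof-heavy: the `SmoothInd` carrier of `cmPrincipalSeries`, two averages, the criterion (class of ★ II-2b §4 ∕ ★ II-3″)
/-- **THE CRITERION INSTANTIATED.**  `v` inert ((G3)-EXPLICIT letters), `χ = (χ₁, χ₂)` continuous, REGULAR, `χ` and `wχ` trivial on `T ∩ K_v`, `⊥ ≠ N ≠ ⊤` a `G_v`-stable subspace of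
`i_G(χ)`, `d ∈ B_v` with `d·w̃ ∈ K₁`, `R`, `R′` left transversals of `K₀ ∕ I`, `K₁ ∕ I`; put `μ = χ(proj d)·δ_B^{1∕2}(d)`, `n = |R|`, `m = |R′|`.  Then
`n⁻¹·m⁻¹μ − n⁻¹(n−1)·m⁻¹(m−1) = 0 ∨ μ⁻¹ = 1 ∨ m⁻¹(m−1) + m⁻¹μ = 0 ∨ n⁻¹ + n⁻¹(n−1)μ⁻¹ = 0` — ★ `criterion_of_iwahoriLine` fed with ★ II-1 `exists_iwahoriPair`
(the plane), ★ II-3″ `exists_iwahoriLine` (the line), ★ `avgProjLinear` at `K₀`, `K₁` (preserving `N`, ★ `avgProj_eq`; landing in the spherical lines ★ II-1 `eq_smul_of_mem_fixedPoints_K0 ∕ _K1`;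
acting by the forms ★ II-2a `avgProj_K0_eq` ∕ ★ II-2b `avgProj_K1_eq`). [cite: Casselman1980, §3] [cite: Borel1976, §4] [cite: Keys1984, §7 Theorem (2)] -/
theorem criterion_of_data (hns : ∀ w' : PlacesOver L v, IsCMField.complexConj L • w'.1 = w'.1) {ϖ : w.1.adicCompletion L}
    (hd : HermitianLattice.UnramifiedLocalConjDatum (galAdicCompletionMap (L := L) (IsCMField.complexConj L) hw) ϖ)
    (g₁ : GL (Fin 3) (w.1.adicCompletion L)) (hg₁ : (g₁ : Matrix (Fin 3) (Fin 3) (w.1.adicCompletion L)) = Matrix.diagonal ![(1 : w.1.adicCompletion L), 1, ϖ])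
    (K0 K1 I : Subgroup (Gqs L v))
    (hK0 : K0 = ((glInt 3 (w.1.adicCompletion L)).subgroupOf
      (unitaryGroupOfForm (galAdicCompletionMap (L := L) (IsCMField.complexConj L) hw) ((StdForm.antidiagonal 3).over (w.1.adicCompletion L)))).comap
        eA.toMulEquiv.toMonoidHom)
    (hK1 : K1 = (((glInt 3 (w.1.adicCompletion L)).map (MulAut.conj g₁).toMonoidHom).subgroupOf
      (unitaryGroupOfForm (galAdicCompletionMap (L := L) (IsCMField.complexConj L) hw) ((StdForm.antidiagonal 3).over (w.1.adicCompletion L)))).comap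
        eA.toMulEquiv.toMonoidHom)
    (hI : I = K0 ⊓ K1)
    (χ₁ : (LocalRing L v)ˣ →* ℂˣ) (χ₂ : ↥(normOneUnits (conjLocal L (IsCMField.complexConj L) v)) →* ℂˣ)
    (h₁ : Continuous fun x => ((χ₁ x : ℂˣ) : ℂ)) (h₂ : Continuous fun x => ((χ₂ x : ℂˣ) : ℂ))
    (hreg : cmTorusCharPair L v χ₁ χ₂ ≠ cmTorusCharPair L v (conjInvChar (conjLocal L (IsCMField.complexConj L) v) χ₁) χ₂)
    (hU : ∀ t : ↥(torusU (conjLocal L (IsCMField.complexConj L) v) (cmLocalForm L 3 v)),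
      (t : ↥(unitaryGroupOfForm (conjLocal L (IsCMField.complexConj L) v) (cmLocalForm L 3 v))) ∈ cmLocalIntegralLevel L 3 (qsForm L) v → cmTorusCharPair L v χ₁ χ₂ t = 1)
    (hUw : ∀ t : ↥(torusU (conjLocal L (IsCMField.complexConj L) v) (cmLocalForm L 3 v)),
      (t : ↥(unitaryGroupOfForm (conjLocal L (IsCMField.complexConj L) v) (cmLocalForm L 3 v))) ∈ cmLocalIntegralLevel L 3 (qsForm L) v →
        cmTorusCharPair L v (conjInvChar (conjLocal L (IsCMField.complexConj L) v) χ₁) χ₂ t = 1)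
    (N : Subrepresentation (cmPrincipalSeries L 3 v (cmTorusCharPair L v χ₁ χ₂))) (hbot : N ≠ ⊥) (htop : N ≠ ⊤)
    (d : ↥(cmBorelTriple L 3 v).P) (hdK1 : (d : ↥(unitaryGroupOfForm (conjLocal L (IsCMField.complexConj L) v) (cmLocalForm L 3 v))) * (![(1 : ↥(unitaryGroupOfForm (conjLocal L (IsCMField.complexConj L) v) (cmLocalForm L 3 v))), eA.symm (weylLongU (galAdicCompletionMap (L := L) (IsCMField.complexConj L) hw) (rfl : (StdForm.antidiagonal 3).over (w.1.adicCompletion L) = _))] 1) ∈ K1)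
    (R : Finset (Gqs L v)) (hR : IsLeftTransversal K0 (K0 ⊓ I) R) (R' : Finset (Gqs L v)) (hR' : IsLeftTransversal K1 (K1 ⊓ I) R') :
    haveI := locallyCompactSpace_cmBorelU L 3 v
    (R.card : ℂ)⁻¹ * ((R'.card : ℂ)⁻¹ * ((((cmTorusCharPair L v χ₁ χ₂) ((cmBorelTriple L 3 v).proj d) : ℂˣ) : ℂ) * ((rootDeltaChar (cmBorelTriple L 3 v).P d : ℂˣ) : ℂ))) -
          (R.card : ℂ)⁻¹ * ((R.card : ℂ) - 1) * ((R'.card : ℂ)⁻¹ * ((R'.card : ℂ) - 1)) = 0 ∨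
      ((((cmTorusCharPair L v χ₁ χ₂) ((cmBorelTriple L 3 v).proj d) : ℂˣ) : ℂ) * ((rootDeltaChar (cmBorelTriple L 3 v).P d : ℂˣ) : ℂ))⁻¹ = 1 ∨
      (R'.card : ℂ)⁻¹ * ((R'.card : ℂ) - 1) + (R'.card : ℂ)⁻¹ * ((((cmTorusCharPair L v χ₁ χ₂) ((cmBorelTriple L 3 v).proj d) : ℂˣ) : ℂ) * ((rootDeltaChar (cmBorelTriple L 3 v).P d : ℂˣ) : ℂ)) = 0 ∨
      (R.card : ℂ)⁻¹ + (R.card : ℂ)⁻¹ * ((R.card : ℂ) - 1) * ((((cmTorusCharPair L v χ₁ χ₂) ((cmBorelTriple L 3 v).proj d) : ℂˣ) : ℂ) * ((rootDeltaChar (cmBorelTriple L 3 v).P d : ℂˣ) : ℂ))⁻¹ = 0 := by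
  haveI := locallyCompactSpace_cmBorelU L 3 v
  -- the Iwahori pair and the Iwahori line
  obtain ⟨f₁, f_w, hf₁, hf_w, h11, h1w, hw1, hww⟩ := exists_iwahoriPair L v w hw eA heA hd g₁ hg₁ K0 K1 I hK0 hK1 hI (cmTorusCharPair L v χ₁ χ₂) hU
  obtain ⟨u, hu0, huN, huI, hline⟩ :=
    K2E3IwahoriLine.exists_iwahoriLine L v w hw eA heA hns hd g₁ hg₁ K0 K1 I hK0 hK1 hI χ₁ χ₂ h₁ h₂ hreg hU hUw N hbot htop f₁ f_w hf₁ hf_w h11 h1w hw1 hww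
  -- the scalar `μ`
  obtain ⟨μ, hμdef⟩ : ∃ μ : ℂ, μ = (((cmTorusCharPair L v χ₁ χ₂) ((cmBorelTriple L 3 v).proj d) : ℂˣ) : ℂ) * ((rootDeltaChar (cmBorelTriple L 3 v).P d : ℂˣ) : ℂ) := ⟨_, rfl⟩
  rw [← hμdef]
  have hμ0 : μ ≠ 0 := by rw [hμdef]; exact mul_ne_zero (Units.ne_zero _) (Units.ne_zero _)
  -- linear independence of the pair (values at `1`, `w̃`)
  have hlin : LinearIndependent ℂ ![f₁, f_w] := by
    refine LinearIndependent.pair_iff.2 fun s t hst => ?_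
    have h0 : (0 : Representation.SmoothInd (cmBorelTriple L 3 v).P
        (Representation.twist (((Representation.trivial ℂ ↥(torusU (conjLocal L (IsCMField.complexConj L) v) (cmLocalForm L 3 v)) ℂ).twist (cmTorusCharPair L v χ₁ χ₂)).comp
          (cmBorelTriple L 3 v).proj) (rootDeltaChar (cmBorelTriple L 3 v).P))).toFun = 0 := by
      have h := Representation.SmoothInd.toFun_smul (0 : ℂ) f₁
      rw [zero_smul] at h
      rw [h, zero_smul]
    have h0' : ∀ g, (0 : Representation.SmoothInd (cmBorelTriple L 3 v).P
        (Representation.twist (((Representation.trivial ℂ ↥(torusU (conjLocal L (IsCMField.complexConj L) v) (cmLocalForm L 3 v)) ℂ).twist (cmTorusCharPair L v χ₁ χ₂)).comp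
          (cmBorelTriple L 3 v).proj) (rootDeltaChar (cmBorelTriple L 3 v).P))).toFun g = 0 := fun g => by rw [h0]; rfl
    have e1 : (s • f₁ + t • f_w).toFun 1 = (0 : Representation.SmoothInd (cmBorelTriple L 3 v).P
        (Representation.twist (((Representation.trivial ℂ ↥(torusU (conjLocal L (IsCMField.complexConj L) v) (cmLocalForm L 3 v)) ℂ).twist (cmTorusCharPair L v χ₁ χ₂)).comp
          (cmBorelTriple L 3 v).proj) (rootDeltaChar (cmBorelTriple L 3 v).P))).toFun 1 := by rw [hst]
    have ew : (s • f₁ + t • f_w).toFun (eA.symm (weylLongU (galAdicCompletionMap (L := L) (IsCMField.complexConj L) hw) (rfl : (StdForm.antidiagonal 3).over (w.1.adicCompletion L) = _))) =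
        (0 : Representation.SmoothInd (cmBorelTriple L 3 v).P
        (Representation.twist (((Representation.trivial ℂ ↥(torusU (conjLocal L (IsCMField.complexConj L) v) (cmLocalForm L 3 v)) ℂ).twist (cmTorusCharPair L v χ₁ χ₂)).comp
          (cmBorelTriple L 3 v).proj) (rootDeltaChar (cmBorelTriple L 3 v).P))).toFun
          (eA.symm (weylLongU (galAdicCompletionMap (L := L) (IsCMField.complexConj L) hw) (rfl : (StdForm.antidiagonal 3).over (w.1.adicCompletion L) = _))) := by rw [hst]
    rw [h0', Representation.SmoothInd.toFun_add, Representation.SmoothInd.toFun_smul, Representation.SmoothInd.toFun_smul,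
      Pi.add_apply, Pi.smul_apply, Pi.smul_apply] at e1 ew
    rw [h11, hw1, smul_eq_mul, smul_eq_mul, mul_one, mul_zero, add_zero] at e1
    rw [h1w, hww, smul_eq_mul, smul_eq_mul, mul_zero, mul_one, zero_add] at ew
    exact ⟨e1, ew⟩
  have he₀ : f₁ + f_w ≠ 0 := by
    intro h
    have := (LinearIndependent.pair_iff.1 hlin 1 1 (by rw [one_smul, one_smul]; exact h)).1
    exact one_ne_zero this
  have he₁ : f₁ + μ⁻¹ • f_w ≠ 0 := by
    intro h
    have := (LinearIndependent.pair_iff.1 hlin 1 μ⁻¹ (by rw [one_smul]; exact h)).1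
    exact one_ne_zero this
  -- the levels are compact open
  have hlev := isOpen_isCompact_levels L v w hw eA g₁ K0 K1 I hK0 hK1 hI
  have hK0c : IsCompact (K0 : Set (Gqs L v)) := hlev.1.2
  have hK1c : IsCompact (K1 : Set (Gqs L v)) := hlev.2.1.2
  -- the two averages as linear maps (smoothness read on the carrier `Gqs L v`: instance path of ★ PS-LEVELS' `IsCompact (K0 : Set (Gqs L v))`)
  have hsm : Representation.IsSmooth (G := Gqs L v) (cmPrincipalSeries L 3 v (cmTorusCharPair L v χ₁ χ₂)) :=
    F0P2pCmPrincipalSeriesInterface.isSmooth_cmPrincipalSeries L v (cmTorusCharPair L v χ₁ χ₂)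
  obtain ⟨P₀, hP₀def⟩ : ∃ P₀ : _ →ₗ[ℂ] _, P₀ = Representation.avgProjLinear (G := Gqs L v) (ρ := cmPrincipalSeries L 3 v (cmTorusCharPair L v χ₁ χ₂)) K0 hsm hK0c := ⟨_, rfl⟩
  obtain ⟨P₁, hP₁def⟩ : ∃ P₁ : _ →ₗ[ℂ] _, P₁ = Representation.avgProjLinear (G := Gqs L v) (ρ := cmPrincipalSeries L 3 v (cmTorusCharPair L v χ₁ χ₂)) K1 hsm hK1c := ⟨_, rfl⟩
  -- `e_K(N) ⊆ N`: `e_K x = |R_x|⁻¹ Σ_r r·x` (★ `avgProj_eq`) and `N` is `G_v`-stable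
  have hTv : ∀ x, ∀ t ∈ (cmPrincipalSeries L 3 v (cmTorusCharPair L v χ₁ χ₂)).stabilizerSubgroup x, (cmPrincipalSeries L 3 v (cmTorusCharPair L v χ₁ χ₂)) t x = x :=
    fun x t ht => ((cmPrincipalSeries L 3 v (cmTorusCharPair L v χ₁ χ₂)).mem_stabilizerSubgroup x t).1 ht
  have hP₀N : ∀ x ∈ N.toSubmodule, P₀ x ∈ N.toSubmodule := fun x hx => by
    obtain ⟨Rx, hRx⟩ := exists_isLeftTransversal (B := K0) hK0c (hsm x)
    rw [hP₀def, Representation.avgProjLinear_apply, Representation.avgProj_eq (G := Gqs L v) (ρ := cmPrincipalSeries L 3 v (cmTorusCharPair L v χ₁ χ₂)) hK0c (hsm x) (hTv x) hRx]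
    exact N.toSubmodule.smul_mem _ (N.toSubmodule.sum_mem fun r _ => N.apply_mem_toSubmodule r hx)
  have hP₁N : ∀ x ∈ N.toSubmodule, P₁ x ∈ N.toSubmodule := fun x hx => by
    obtain ⟨Rx, hRx⟩ := exists_isLeftTransversal (B := K1) hK1c (hsm x)
    rw [hP₁def, Representation.avgProjLinear_apply, Representation.avgProj_eq (G := Gqs L v) (ρ := cmPrincipalSeries L 3 v (cmTorusCharPair L v χ₁ χ₂)) hK1c (hsm x) (hTv x) hRx]
    exact N.toSubmodule.smul_mem _ (N.toSubmodule.sum_mem fun r _ => N.apply_mem_toSubmodule r hx)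
  have hP₀W : ∀ x, P₀ x ∈ Submodule.span ℂ ({f₁ + f_w} : Set _) := by
    intro x
    have hmem := Representation.avgProj_mem_fixedPoints (G := Gqs L v) (ρ := cmPrincipalSeries L 3 v (cmTorusCharPair L v χ₁ χ₂)) (K := K0) hK0c (hsm x)
    have h := eq_smul_of_mem_fixedPoints_K0 L v w hw eA heA hd g₁ hg₁ K0 K1 I hK0 hK1 hI (cmTorusCharPair L v χ₁ χ₂) f₁ f_w _ hf₁ hf_w hmem h11 h1w hw1 hww
    rw [hP₀def, Representation.avgProjLinear_apply, h]
    exact Submodule.smul_mem _ _ (Submodule.subset_span rfl)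
  have hP₁W : ∀ x, P₁ x ∈ Submodule.span ℂ ({f₁ + μ⁻¹ • f_w} : Set _) := by
    intro x
    have hmem := Representation.avgProj_mem_fixedPoints (G := Gqs L v) (ρ := cmPrincipalSeries L 3 v (cmTorusCharPair L v χ₁ χ₂)) (K := K1) hK1c (hsm x)
    have h := eq_smul_of_mem_fixedPoints_K1 L v w hw eA heA hd g₁ hg₁ K0 K1 I hK0 hK1 hI (cmTorusCharPair L v χ₁ χ₂) d hdK1 f₁ f_w _ hf₁ hf_w hmem h11 h1w hw1 hww
    rw [← hμdef] at h
    rw [hP₁def, Representation.avgProjLinear_apply, h]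
    exact Submodule.smul_mem _ _ (Submodule.subset_span rfl)
  have hP₀f : ∀ x y : ℂ, P₀ (x • f₁ + y • f_w) = ((R.card : ℂ)⁻¹ * x + ((R.card : ℂ)⁻¹ * ((R.card : ℂ) - 1)) * y) • (f₁ + f_w) := by
    intro x y
    rw [hP₀def, Representation.avgProjLinear_apply,
      avgProj_K0_eq L v w hw eA heA hd g₁ hg₁ K0 K1 I hK0 hK1 hI (cmTorusCharPair L v χ₁ χ₂) hU R hR f₁ f_w hf₁ hf_w h11 h1w hw1 hww x y]
    congr 1
    ring
  have hP₁f : ∀ x y : ℂ, P₁ (x • f₁ + y • f_w) = (((R'.card : ℂ)⁻¹ * ((R'.card : ℂ) - 1)) * x + ((R'.card : ℂ)⁻¹ * μ) * y) • (f₁ + μ⁻¹ • f_w) := by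
    intro x y
    have h := avgProj_K1_eq L v w hw eA heA hd g₁ hg₁ K0 K1 I hK0 hK1 hI (cmTorusCharPair L v χ₁ χ₂) hU d hdK1 R' hR' f₁ f_w hf₁ hf_w h11 h1w hw1 hww x y
    rw [← hμdef] at h
    rw [hP₁def, Representation.avgProjLinear_apply, h]
    congr 1
    ring
  -- the criterion
  exact criterion_of_iwahoriLine N.toSubmodule f₁ f_w (f₁ + f_w) (f₁ + μ⁻¹ • f_w) hlin he₀ he₁ μ⁻¹
    ((R.card : ℂ)⁻¹) ((R.card : ℂ)⁻¹ * ((R.card : ℂ) - 1)) ((R'.card : ℂ)⁻¹ * ((R'.card : ℂ) - 1)) ((R'.card : ℂ)⁻¹ * μ)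
    P₀ P₁ hP₀N hP₁N hP₀W hP₁W hP₀f hP₁f u hu0 huN huI hline

/-! ## §4 The quartet: `χ₁(ϖ_E) ∈ {q⁻², −q⁻¹}` -/

include heA in
set_option maxHeartbeats 6400000 in
set_option synthInstance.maxHeartbeats 400000 in
-- statement∕proof-heavy: the `SmoothInd` carrier of `cmPrincipalSeries` and the (G3) letters (class of ★ II-2b §4)
/-- **THE QUARTET AT AN INERT PLACE.**  `v` inert ((G3)-EXPLICIT letters + `hunr`), `χ = (χ₁, χ₂)` continuous with `χ₁` NON-UNITARY and CONTRACTING, `χ` trivial on `T ∩ K_v` (`hU`),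
`i_G(χ)` REDUCIBLE: then for every uniformiser unit `ϖ_E` of `E_v`, `χ₁(ϖ_E) = q_v⁻²` or `χ₁(ϖ_E) = −q_v⁻¹` (`q_v = #(𝓞_{L⁺}∕v)`) — Keys' reducibility points (a) `λ_s = |·|_E` and
(c) `λ_s = η|·|_E^{1∕2}` (`η` unramified quadratic) of the unramified non-unitary principal series with `Re s > 0`: §3 with the explicit `d` of ★ `exists_borel_mul_weyl_mem_K1_explicit`
(`μ = χ₁(ϖ_E)⁻¹ q²`), the indices `[K₀:I] = q³+1`, `[K₁:I] = q+1` (★ `index_inf_subgroupOf_eq_of_unramified`), and §2. [cite: Keys1984, §7 Theorem (2) (a)(c) p. 126]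
[cite: Casselman1980, §3] [cite: Borel1976, §4] [cite: Rogawski1990, §12.2 (1)(2) p. 173] [cite: Tits1979, §2.4] -/
theorem apply_uniformizer_eq_or_eq (hns : ∀ w' : PlacesOver L v, IsCMField.complexConj L • w'.1 = w'.1)
    (hunr : Algebra.IsUnramifiedIn (𝓞 L) v.asIdeal) {ϖ : w.1.adicCompletion L}
    (hd : HermitianLattice.UnramifiedLocalConjDatum (galAdicCompletionMap (L := L) (IsCMField.complexConj L) hw) ϖ)
    (g₁ : GL (Fin 3) (w.1.adicCompletion L)) (hg₁ : (g₁ : Matrix (Fin 3) (Fin 3) (w.1.adicCompletion L)) = Matrix.diagonal ![(1 : w.1.adicCompletion L), 1, ϖ])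
    (K0 K1 I : Subgroup (Gqs L v))
    (hK0 : K0 = ((glInt 3 (w.1.adicCompletion L)).subgroupOf
      (unitaryGroupOfForm (galAdicCompletionMap (L := L) (IsCMField.complexConj L) hw) ((StdForm.antidiagonal 3).over (w.1.adicCompletion L)))).comap
        eA.toMulEquiv.toMonoidHom)
    (hK1 : K1 = (((glInt 3 (w.1.adicCompletion L)).map (MulAut.conj g₁).toMonoidHom).subgroupOf
      (unitaryGroupOfForm (galAdicCompletionMap (L := L) (IsCMField.complexConj L) hw) ((StdForm.antidiagonal 3).over (w.1.adicCompletion L)))).comap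
        eA.toMulEquiv.toMonoidHom)
    (hI : I = K0 ⊓ K1)
    (χ₁ : (LocalRing L v)ˣ →* ℂˣ) (χ₂ : ↥(normOneUnits (conjLocal L (IsCMField.complexConj L) v)) →* ℂˣ)
    (h₁ : Continuous fun x => ((χ₁ x : ℂˣ) : ℂ)) (h₂ : Continuous fun x => ((χ₂ x : ℂˣ) : ℂ))
    (hnu : ∃ x, ‖((χ₁ x : ℂˣ) : ℂ)‖ ≠ 1)
    (hcontr : ∀ x : (LocalRing L v)ˣ, unitModulusChar (LocalRing L v) x < 1 → ‖((χ₁ x : ℂˣ) : ℂ)‖ < 1)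
    (hU : ∀ t : ↥(torusU (conjLocal L (IsCMField.complexConj L) v) (cmLocalForm L 3 v)),
      (t : ↥(unitaryGroupOfForm (conjLocal L (IsCMField.complexConj L) v) (cmLocalForm L 3 v))) ∈ cmLocalIntegralLevel L 3 (qsForm L) v → cmTorusCharPair L v χ₁ χ₂ t = 1)
    (hred : ∃ N : Subrepresentation (cmPrincipalSeries L 3 v (cmTorusCharPair L v χ₁ χ₂)), N ≠ ⊥ ∧ N ≠ ⊤)
    (ϖE : (LocalRing L v)ˣ) (hϖE : ∀ w' : PlacesOver L v, Valued.v ((ϖE : LocalRing L v) w') = WithZero.exp (-1 : ℤ)) :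
    ((χ₁ ϖE : ℂˣ) : ℂ) = ((Nat.card (𝓞 ↥(maximalRealSubfield L) ⧸ v.asIdeal) : ℂ) ^ 2)⁻¹ ∨
      ((χ₁ ϖE : ℂˣ) : ℂ) = -((Nat.card (𝓞 ↥(maximalRealSubfield L) ⧸ v.asIdeal) : ℂ))⁻¹ := by
  classical
  haveI := locallyCompactSpace_cmBorelU L 3 v
  have hc1 : IsCMField.complexConj L ≠ 1 := IsCMField.complexConj_ne_one L
  haveI : Algebra.IsQuadraticExtension ↥(maximalRealSubfield L) L := IsCMField.isQuadraticExtension L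
  -- §1 data: regular, `χ₂ = 1`, `χ₁` unramified, `wχ` unramified
  have hreg := K2E3NonUnitaryCharacterDichotomy.cmTorusCharPair_ne_weyl_of_exists_norm_ne_one L v hns χ₁ χ₂ h₁ hnu
  have hχ₂ : χ₂ = 1 := eq_one_of_levelTrivial L v hns χ₁ χ₂ hU
  have hχ₁U : ∀ u ∈ (Submonoid.pi Set.univ (fun w' : PlacesOver L v => (w'.1.adicCompletionIntegers L).toSubring.toSubmonoid)).units, χ₁ u = 1 :=
    fun u hu => K2E3SphericalCFunctionUnramifiedHypotheses.apply_eq_one_of_mem_unitsIntegers_of_trivial L v hns χ₁ χ₂ hU u hu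
  have hUw := weyl_levelTrivial L v hns χ₁ χ₂ hU
  obtain ⟨N, hbot, htop⟩ := hred
  -- the explicit `d`, the transversals, and the criterion
  obtain ⟨d, hdK1, hdw, hduni, hdδ⟩ := exists_borel_mul_weyl_mem_K1_explicit L v w hw eA heA hd g₁ hg₁ K1 hK1
  have hlev := isOpen_isCompact_levels L v w hw eA g₁ K0 K1 I hK0 hK1 hI
  obtain ⟨R, hR⟩ := exists_isLeftTransversal (B := K0) (T := I) hlev.1.2 hlev.2.2.1
  obtain ⟨R', hR'⟩ := exists_isLeftTransversal (B := K1) (T := I) hlev.2.1.2 hlev.2.2.1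
  have hcrit := criterion_of_data L v w hw eA heA hns hd g₁ hg₁ K0 K1 I hK0 hK1 hI χ₁ χ₂ h₁ h₂ hreg hU hUw N hbot htop d hdK1 R hR R' hR'
  -- the indices `|R| = q³ + 1`, `|R′| = q + 1`
  obtain ⟨q, hqdef⟩ : ∃ q : ℕ, q = Nat.card (𝓞 ↥(maximalRealSubfield L) ⧸ v.asIdeal) := ⟨_, rfl⟩
  rw [← hqdef]
  letI : Fintype 𝓀[w.1.adicCompletion L] := Fintype.ofFinite _
  obtain ⟨σk, hσk⟩ := UnitaryLatticeTree.exists_residueField_ringHom_of_v_eq (K := w.1.adicCompletion L)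
    (fun y => valued_galAdicCompletionMap (L := L) (IsCMField.complexConj L) hw y)
  have hidx := UnitaryLatticeTree.index_inf_subgroupOf_eq_of_unramified hd
    (UnitaryLatticeTree.galAdicCompletionMap_mem_valuedInteger (IsCMField.complexConj L) v w hw) σk hσk
    (UnitaryLatticeTree.fintypeCard_valuedResidueField_eq_sq_of_inert (IsCMField.complexConj L) v hc1 hunr w hw)
    (UnitaryLatticeTree.residueHom_galAdicCompletionMap_eq_pow_valued (IsCMField.complexConj L) v hc1 hunr w hw σk hσk) g₁ hg₁
  rw [← hqdef] at hidx
  have hKI0 : K0 ⊓ I = I := by rw [hI]; exact inf_eq_right.2 inf_le_left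
  have hKI1 : K1 ⊓ I = I := by rw [hI]; exact inf_eq_right.2 inf_le_right
  have hRcard : R.card = q ^ 3 + 1 := by
    rw [card_eq_index_of_isLeftTransversal hR, hKI0, hI, hK0, hK1, ← Subgroup.comap_inf, ← Subgroup.relIndex, Subgroup.relIndex_comap,
      Subgroup.map_comap_eq_self_of_surjective eA.surjective, Subgroup.relIndex]
    exact hidx.1
  have hR'card : R'.card = q + 1 := by
    rw [card_eq_index_of_isLeftTransversal hR', hKI1, hI, hK0, hK1, ← Subgroup.comap_inf, ← Subgroup.relIndex, Subgroup.relIndex_comap,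
      Subgroup.map_comap_eq_self_of_surjective eA.surjective, Subgroup.relIndex]
    exact hidx.2
  have hn : (R.card : ℂ) = (q : ℂ) ^ 3 + 1 := by rw [hRcard]; push_cast; ring
  have hm : (R'.card : ℂ) = (q : ℂ) + 1 := by rw [hR'card]; push_cast; ring
  rw [hn, hm] at hcrit
  -- `μ = χ₁(ϖ_E)⁻¹ · q²`
  have hq2 : 2 ≤ q := by
    haveI : Finite (𝓞 ↥(maximalRealSubfield L) ⧸ v.asIdeal) := Ideal.finiteQuotientOfFreeOfNeBot v.asIdeal v.ne_bot
    haveI : Nontrivial (𝓞 ↥(maximalRealSubfield L) ⧸ v.asIdeal) := Ideal.Quotient.nontrivial_iff.2 v.isPrime.ne_top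
    rw [hqdef]; exact Finite.one_lt_card
  have hmod : (((unitModulusChar (LocalRing L v) (torusEntry (conjLocal L (IsCMField.complexConj L) v) (cmLocalForm L 3 v) 0 ((cmBorelTriple L 3 v).proj d)) : ℝ≥0) : ℝ) : ℂ) =
      (q : ℂ) ^ 2 := by
    have h := coe_unitModulusChar_uniformizer_eq L v hns hunr _ hduni
    rw [← hqdef, map_inv, NNReal.coe_inv, Complex.ofReal_inv, inv_eq_iff_eq_inv, inv_inv] at h
    exact h
  have hza : χ₁ ϖE = (χ₁ (torusEntry (conjLocal L (IsCMField.complexConj L) v) (cmLocalForm L 3 v) 0 ((cmBorelTriple L 3 v).proj d)))⁻¹ := by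
    rw [← map_inv]
    have h := K2E3SphericalCFunctionShellExpansion.apply_eq_apply_uniformizer_zpow L v χ₁ hχ₁U _ hduni ϖE 1 (fun w' => by rw [hϖE w'])
    rw [zpow_one] at h
    exact h
  have hμval : (((cmTorusCharPair L v χ₁ χ₂) ((cmBorelTriple L 3 v).proj d) : ℂˣ) : ℂ) * ((rootDeltaChar (cmBorelTriple L 3 v).P d : ℂˣ) : ℂ) =
      (((χ₁ ϖE : ℂˣ) : ℂ))⁻¹ * (q : ℂ) ^ 2 := by
    rw [hdδ, hmod, cmTorusCharPair, torusCharPair_apply, hχ₂, MonoidHom.one_apply, mul_one, hza, Units.val_inv_eq_inv_val, inv_inv]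
  -- the arithmetic
  exact quartet_algebra q hq2 _ _ (Units.ne_zero _)
    (K2E3SphericalCFunctionUnramifiedHypotheses.norm_apply_uniformizer_lt_one_of_contracting L v hns χ₁ hcontr ϖE hϖE) hμval hcrit

end Summit.HodgeConjecture.HodgeConjecture.Cruxes.H413.K2E3KeysThmTwoIwahoriQuartet

end
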